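import Mathlib
import HarnessLib
import Summits.NavierStokesRegularity.NavierStokesRegularity.Theses.UnthreadedRigidityDoor
import Summits.NavierStokesRegularity.NavierStokesRegularity.Theorems.UnthreadedDoorAntidynamoWallOneInstantAxisymmetric
import Summits.NavierStokesRegularity.NavierStokesRegularity.Theorems.ThreadingFluxPlatonicInfinitesimalRotation

/-!
# Route `UnthreadedDoor` / `ThreadingFlux`, crux `PoloidalLiouville` (stmt-NavierStokesRegularity-1222), antidynamo v2 skeleton (sha16 `4ebf5683127b`),
# WALL `stub_scalarLiouville`: ⟨1222⟩ BELOW ⟨27585⟩ `UnthreadedRigidity` ON THE INERTIAL STRATUM — and exactly where the by-name domination stops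

Support file (seat leafhand-ns-unthreadeddoor-3 g14, cell decomp-ns), `--supports stmt-NavierStokesRegularity-1222 --as helper`; theorems only.

The window-rigidity crux `UnthreadedRigidity` of route `UnthreadedRigidityDoor` (stmt-NavierStokesRegularity-27585, OPEN, taken BY NAME as a
hypothesis) says: a continuous, divergence-free, OSEEN-MILD, sub-window-bounded field on an open preconnected time set whose vorticity is tangent to
the spheres about a FIXED `x₀` is infinitesimally axisymmetric about one fixed axis through `x₀`.  The crux ⟨1222⟩ lives in the larger DUALITY class
(`IsBoundedAncientMildSolution`): by the tree's Oseen gauge (`Theorems.oseen_gauge_of_aestronglyMeasurable`) such a `v` is `v(t) = w(t, · − A(t)) + c(t)`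
with `w` Oseen-mild and a frame path `A` that is only continuous (real-analytic once `curl v ≢ 0`, `OneInstant.curl_eq_zero_or_exists_analytic_gauge`),
so the Oseen-mild representative is unthreaded about the MOVING centre `x₀ − A(t)`, where ⟨27585⟩ does not apply; re-centring restores the fixed
centre and destroys the Oseen identity (it is `v` again).  This file records, kernel-checked, how far ⟨27585⟩ reaches into ⟨1222⟩ BY NAME:

* ★ `FrameSlot.constant_of_unthreadedRigidity_of_mild_modDrift` — ASSUMING `UnthreadedRigidity`: a flow of the wall's class (bounded ancient duality-mild,
  measurable slices, jointly smooth, vorticity tangent to the spheres about `x₀`) that is an Oseen-mild bounded continuous field `U` PLUS A PURE DRIFT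
  `d(t)` (`v(t,x) = U(t,x) + d(t)`) has spatially constant slices.  [27585 on `S = (−∞,0)` applied to `U` (same vorticity, same divergence); the skew
  generator is straightened by `Platonic.exists_isAxisymmetric_conj_of_fderiv`; the straightened vorticity of ONE slice is axisymmetric
  (`IsAxisymmetric.curl`, the drift is invisible to `curl`); `OneInstant.constant_of_curl_axisymmetric_slice` (KNSS Thm 5.2 transfer) concludes.]
* ★ `FrameSlot.constant_of_unthreadedRigidity_of_oseenMild` — the case `d = 0`: ⟨27585⟩ decides every flow of ⟨1222⟩'s class that is ITSELF Oseen-mild.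
* ★ `FrameSlot.constant_of_unthreadedRigidity_of_affineGauge` — the case of an AFFINE frame path `A(t) = a + t k` (any drift `c`): removable by the
  constant Galilean boost and translation covariance of the bounded Oseen-ancient class (`OneInstant.oseenAncient_boost/translate`).
* `FrameSlot.poloidalLiouville_oseenMild_of_unthreadedRigidity` — the crux's own binder order with ONE extra binder (the Oseen identity):
  `UnthreadedRigidity →` «`PoloidalLiouville` restricted to Oseen-mild flows».

RESIDUAL (not provable here, recorded for the planners): ⟨1222⟩ ⟸ ⟨27585⟩ in full needs ⟨27585⟩ for the DRIFT class — «Oseen-mild up to a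
time-dependent (analytic) translation», equivalently its research stub `StubShearedRigidity` without the Oseen binder — because a non-affine
analytic frame path is exactly the accelerated-frame symmetry of `Literature.Barriers.NavierStokesRegularity.GalileanFrameSlot`
(Tao 2013 §3: `ũ(t,x) = u(t, x − ∫v) + v(t)`, `p̃ = p − x·v′`), under which tangency about a fixed centre and the vorticity equation are
invariant but the Oseen identity is not.

HONEST LABEL: conditional glue (⟨27585⟩ is OPEN and appears as a hypothesis); nothing here proves `stub_scalarLiouville`, `PoloidalLiouville` (1222),
`UnthreadedRigidity` (27585), or bears on Navier–Stokes regularity; no summit statement is proved. [folklore]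
[cite: KochNadirashviliSereginSverak2009, §1 p. 3, §4 (4.3)–(4.4), Thm 5.2 (arXiv:0709.3599 pp. 3, 8–10); MajdaBertozziCUP2002, §1.2; Tao2013Localisation, §3]
-/

noncomputable section

-- the summit and its single sub-problem share the name (CONVENTIONS §1)
set_option linter.dupNamespace false

open scoped Topology InnerProductSpace RealInnerProductSpace ContDiff
open Filter Set Function Metric MeasureTheory
open Literature.Analysis Literature.Analysis.FluidPDE

namespace Summit.NavierStokesRegularity.NavierStokesRegularity.Theorems.PoloidalLiouville.Antidynamo

open Summit.NavierStokesRegularity.NavierStokesRegularity.Theorems.PoloidalLiouville.NetFlux (E3)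
open Summit.NavierStokesRegularity.NavierStokesRegularity.Theorems.PoloidalLiouville.CellFlux (conjAxis conjAxis_apply)

namespace FrameSlot

/-- ★ **⟨27585⟩ DECIDES ⟨1222⟩ MODULO A PURE DRIFT.**  Assume `UnthreadedRigidity` (stmt-27585, OPEN — a hypothesis).  Let `v` be a flow of the wall's
class: bounded ancient mild (duality sense, `ν = 1`), measurable slices, jointly smooth on `(−∞,0) × ℝ³`, vorticity tangent to the spheres about `x₀`.
If `v(t,x) = U(t,x) + d(t)` for `t < 0` with `U` continuous and uniformly bounded on `(−∞,0) × ℝ³` and satisfying the Oseen integral identity between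
any two negative times, then every slice of `v` is spatially constant.  (`U` has the vorticity and the divergence of `v`, so ⟨27585⟩ applies to `U` on
the window `(−∞,0)` with the fixed centre `x₀`; its skew generator is conjugated to a multiple of the standard one, the straightened slice `U(−1)` is
`IsAxisymmetric`, hence so is its curl, which is the straightened vorticity of `v(−1)`; KNSS transfer `OneInstant.constant_of_curl_axisymmetric_slice`.)
[cite: KochNadirashviliSereginSverak2009, Thm 5.2 and §4 (arXiv:0709.3599 pp. 8–10); MajdaBertozziCUP2002, §1.2] -/
theorem constant_of_unthreadedRigidity_of_mild_modDrift
    (h27585 : Summit.NavierStokesRegularity.NavierStokesRegularity.Theses.UnthreadedRigidityDoor.UnthreadedRigidity)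
    (v : ℝ → EuclideanSpace ℝ (Fin 3) → EuclideanSpace ℝ (Fin 3)) (x₀ : EuclideanSpace ℝ (Fin 3))
    (hB : Literature.Analysis.FluidPDE.IsBoundedAncientMildSolution 1 v)
    (hm : ∀ t < 0, AEStronglyMeasurable (v t) volume)
    (hsm : ContDiffOn ℝ (⊤ : ℕ∞) (Function.uncurry v) (Set.Iio 0 ×ˢ Set.univ))
    (hun : ∀ t < 0, ∀ x, ⟪x - x₀, curl (v t) x⟫ = 0)
    (U : ℝ → EuclideanSpace ℝ (Fin 3) → EuclideanSpace ℝ (Fin 3)) (d : ℝ → EuclideanSpace ℝ (Fin 3))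
    (hUc : ContinuousOn (Function.uncurry U) (Set.Iio 0 ×ˢ Set.univ))
    (hUb : ∃ K : ℝ, ∀ t < 0, ∀ x, ‖U t x‖ ≤ K)
    (hUmild : ∀ s t : ℝ, s < t → t < 0 → ∀ x,
      U t x = UnboundedOperators.heatExtension (U s) (t - s) x - oseenDuhamel 1 s U U t x)
    (hrep : ∀ t < 0, ∀ x, v t x = U t x + d t) :
    ∀ t < 0, ∃ b : EuclideanSpace ℝ (Fin 3), ∀ x, v t x = b := by
  have hsm' : IsSmoothSpaceTimeOn (Iio 0) v := hsm
  -- the slices of `U` are the slices of `v` minus a constant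
  have hUt : ∀ t < 0, U t = fun x => v t x - d t := fun t ht =>
    funext fun x => by rw [hrep t ht x, add_sub_cancel_right]
  have hv1 : ∀ t < 0, ContDiff ℝ 1 (v t) := fun t ht => (hsm'.contDiff_slice ht).of_le (by norm_cast)
  have hU1 : ∀ t < 0, ContDiff ℝ 1 (U t) := fun t ht => by
    rw [hUt t ht]
    exact (hv1 t ht).sub contDiff_const
  have hfd : ∀ t < 0, ∀ x, fderiv ℝ (U t) x = fderiv ℝ (v t) x := fun t ht x => by
    rw [hUt t ht]
    exact fderiv_sub_const (d t)
  have hcurlU : ∀ t < 0, ∀ x, curl (U t) x = curl (v t) x := fun t ht x => by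
    rw [curl_eq_curlCLM, curl_eq_curlCLM, hfd t ht x]
  -- ## the hypotheses of ⟨27585⟩ for `U` on the window `(−∞,0)`
  have hdivU : ∀ t ∈ Iio (0 : ℝ), VectorCalculus.IsDivFree (U t) := fun t ht x => by
    have h := (hB.isAncientMildSolution.1 t ht).isDivFree_of_contDiff (hv1 t ht) x
    unfold VectorCalculus.divergence at h ⊢
    rw [hfd t ht x]
    exact h
  have hmildU : ∀ s ∈ Iio (0 : ℝ), ∀ t ∈ Iio (0 : ℝ), s < t → ∀ x,
      U t x = UnboundedOperators.heatExtension (U s) (t - s) x - oseenDuhamel 1 s U U t x :=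
    fun s _ t ht hst x => hUmild s t hst ht x
  have hbddU : ∀ τ ∈ Iio (0 : ℝ), ∃ B : ℝ, ∀ t ∈ Iio (0 : ℝ), t ≤ τ → ∀ x, ‖U t x‖ ≤ B := by
    obtain ⟨K, hK⟩ := hUb
    exact fun τ _ => ⟨K, fun t ht _ x => hK t ht x⟩
  have hunU : ∀ t ∈ Iio (0 : ℝ), ∀ x, ⟪curl (U t) x, x - x₀⟫ = 0 := fun t ht x => by
    rw [hcurlU t ht x, real_inner_comm]
    exact hun t ht x
  obtain ⟨A, hskew, hA0, hsym⟩ :=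
    h27585 (Iio 0) isOpen_Iio isPreconnected_Iio U x₀ hUc hdivU hmildU hbddU hunU
  -- ## one instant: straighten the generator, the slice `U(−1)` is axisymmetric in the adapted frame
  have ht₁ : (-1 : ℝ) < 0 := by norm_num
  have hdiff : Differentiable ℝ (U (-1)) := (hU1 (-1) ht₁).differentiable (by simp)
  obtain ⟨L, α, -, -, hax⟩ :=
    Platonic.exists_isAxisymmetric_conj_of_fderiv hskew hA0 x₀ hdiff (hsym (-1) ht₁)
  have hL : Differentiable ℝ (fun y : E3 => L y) := by
    simpa using L.toContinuousLinearEquiv.differentiable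
  have hLs : Differentiable ℝ (fun y : E3 => L.symm y) := by
    simpa using L.symm.toContinuousLinearEquiv.differentiable
  have hdiffc : Differentiable ℝ (fun z => L (U (-1) (L.symm z + x₀))) :=
    hL.comp (hdiff.comp (hLs.add_const x₀))
  have haxc : IsAxisymmetric (curl (fun z => L (U (-1) (L.symm z + x₀)))) := hax.curl hdiffc
  -- ## the drift is invisible to the vorticity: the straightened vorticity of `v(−1)` is the same field
  have hkey : curl (conjAxis L x₀ (v (-1))) = curl (fun z => L (U (-1) (L.symm z + x₀))) := by
    have e : conjAxis L x₀ (v (-1)) = fun z => L (U (-1) (L.symm z + x₀)) + L (d (-1)) := by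
      funext z
      rw [conjAxis_apply, hrep (-1) ht₁, map_add]
    funext z
    rw [e, curl_eq_curlCLM, curl_eq_curlCLM, fderiv_add_const]
  refine OneInstant.constant_of_curl_axisymmetric_slice v x₀ hB hm hsm hun ⟨-1, ht₁, L, x₀, ?_⟩
  rw [hkey]
  exact haxc

/-- ★ **⟨27585⟩ DECIDES THE OSEEN-MILD STRATUM OF ⟨1222⟩.**  Assume `UnthreadedRigidity` (stmt-27585, OPEN — a hypothesis).  A flow of the wall's class
(bounded ancient duality-mild, measurable slices, jointly smooth, vorticity tangent to the spheres about `x₀`) that ITSELF satisfies the Oseen integral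
identity `v(t) = e^{(t−s)Δ}v(s) − B¹_s(v,v)(t)` for all `s < t < 0` (KNSS's bounded ancient MILD solutions, the inertial frame) has spatially constant
slices. [cite: KochNadirashviliSereginSverak2009, §1 p. 3, §4 (i)–(ii), Thm 5.2 (arXiv:0709.3599 pp. 3, 8–10)] -/
theorem constant_of_unthreadedRigidity_of_oseenMild
    (h27585 : Summit.NavierStokesRegularity.NavierStokesRegularity.Theses.UnthreadedRigidityDoor.UnthreadedRigidity)
    (v : ℝ → EuclideanSpace ℝ (Fin 3) → EuclideanSpace ℝ (Fin 3)) (x₀ : EuclideanSpace ℝ (Fin 3))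
    (hB : Literature.Analysis.FluidPDE.IsBoundedAncientMildSolution 1 v)
    (hm : ∀ t < 0, AEStronglyMeasurable (v t) volume)
    (hsm : ContDiffOn ℝ (⊤ : ℕ∞) (Function.uncurry v) (Set.Iio 0 ×ˢ Set.univ))
    (hun : ∀ t < 0, ∀ x, ⟪x - x₀, curl (v t) x⟫ = 0)
    (hmild : ∀ s t : ℝ, s < t → t < 0 → ∀ x,
      v t x = UnboundedOperators.heatExtension (v s) (t - s) x - oseenDuhamel 1 s v v t x) :
    ∀ t < 0, ∃ b : EuclideanSpace ℝ (Fin 3), ∀ x, v t x = b := by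
  obtain ⟨M, hM⟩ := hB.isBoundedOn
  exact constant_of_unthreadedRigidity_of_mild_modDrift h27585 v x₀ hB hm hsm hun v (fun _ => 0) hsm.continuousOn
    ⟨M, fun t ht x => hM t ht x⟩ hmild (fun t _ x => by rw [add_zero])

/-- ★ **⟨27585⟩ DECIDES ⟨1222⟩ FOR AN AFFINE GALILEAN GAUGE.**  Assume `UnthreadedRigidity` (stmt-27585, OPEN — a hypothesis).  Let `v` be a flow of the
wall's class and suppose its Oseen gauge has an AFFINE frame path: `v(t,x) = W(t, x − (a + t k)) + c(t)` for `t < 0`, with `W` continuous, uniformly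
bounded, weakly divergence-free and Oseen-mild on `(−∞,0) × ℝ³`, constant vectors `a, k` and any drift `c`.  Then every slice of `v` is spatially
constant: the constant boost `W♭(t,y) = W(t, y − t k) + k` and the translate `U(t,y) = W♭(t, y − a)` stay in the bounded Oseen-ancient class
(`OneInstant.oseenAncient_boost`, `OneInstant.oseenAncient_translate`), and `v = U + (c − k)` is the previous theorem's shape.  The NON-affine
(accelerating) frame paths are exactly what this file cannot remove (module docstring, RESIDUAL).
[cite: KochNadirashviliSereginSverak2009, §1 p. 3 and §4 (4.3)–(4.4) (arXiv:0709.3599 pp. 3, 8); MajdaBertozziCUP2002, §1.2] -/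
theorem constant_of_unthreadedRigidity_of_affineGauge
    (h27585 : Summit.NavierStokesRegularity.NavierStokesRegularity.Theses.UnthreadedRigidityDoor.UnthreadedRigidity)
    (v : ℝ → EuclideanSpace ℝ (Fin 3) → EuclideanSpace ℝ (Fin 3)) (x₀ : EuclideanSpace ℝ (Fin 3))
    (hB : Literature.Analysis.FluidPDE.IsBoundedAncientMildSolution 1 v)
    (hm : ∀ t < 0, AEStronglyMeasurable (v t) volume)
    (hsm : ContDiffOn ℝ (⊤ : ℕ∞) (Function.uncurry v) (Set.Iio 0 ×ˢ Set.univ))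
    (hun : ∀ t < 0, ∀ x, ⟪x - x₀, curl (v t) x⟫ = 0)
    (W : ℝ → EuclideanSpace ℝ (Fin 3) → EuclideanSpace ℝ (Fin 3)) (a k : EuclideanSpace ℝ (Fin 3))
    (c : ℝ → EuclideanSpace ℝ (Fin 3))
    (hWc : ContinuousOn (Function.uncurry W) (Set.Iio 0 ×ˢ Set.univ))
    (hWb : ∃ K : ℝ, ∀ t < 0, ∀ y, ‖W t y‖ ≤ K)
    (hWdiv : ∀ t < 0, IsWeaklyDivFree (W t))
    (hWmild : ∀ s t : ℝ, s < t → t < 0 → ∀ y,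
      W t y = UnboundedOperators.heatExtension (W s) (t - s) y - oseenDuhamel 1 s W W t y)
    (hrep : ∀ t < 0, ∀ x, v t x = W t (x - (a + t • k)) + c t) :
    ∀ t < 0, ∃ b : EuclideanSpace ℝ (Fin 3), ∀ x, v t x = b := by
  -- constant boost by `−k` (re-centred at `t₁ = 0`), then translation by `−a`
  obtain ⟨hc₁, hb₁, hm₁⟩ := OneInstant.oseenAncient_boost hWc hWb hWdiv hWmild (-k) 0
  obtain ⟨hc₂, hb₂, hm₂⟩ := OneInstant.oseenAncient_translate hc₁ hb₁ hm₁ (-a)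
  refine constant_of_unthreadedRigidity_of_mild_modDrift h27585 v x₀ hB hm hsm hun
    (fun t y => (fun t y => W t (y + (t - 0) • (-k)) - -k) t (y + -a)) (fun t => c t - k) hc₂ hb₂ hm₂ fun t ht x => ?_
  have e : x + -a + (t - 0) • -k = x - (a + t • k) := by
    rw [sub_zero, smul_neg]
    abel
  show v t x = W t (x + -a + (t - 0) • -k) - -k + (c t - k)
  rw [e, hrep t ht x]
  abel

/-- **THE CRUX'S OWN SHAPE WITH ONE EXTRA BINDER.**  `UnthreadedRigidity →` «`PoloidalLiouville` (stmt-1222, the decl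
`Theses.ThreadingFlux.PoloidalLiouville`) restricted to flows satisfying the Oseen integral identity»: same binders and order as the crux, plus the
Oseen binder after the smoothness binder.  Dropping that binder is the open residual (module docstring). [cite: KochNadirashviliSereginSverak2009,
§4 (i)–(ii), Thm 5.2 (arXiv:0709.3599 pp. 8–10)] -/
theorem poloidalLiouville_oseenMild_of_unthreadedRigidity
    (h27585 : Summit.NavierStokesRegularity.NavierStokesRegularity.Theses.UnthreadedRigidityDoor.UnthreadedRigidity) :
    ∀ v : ℝ → EuclideanSpace ℝ (Fin 3) → EuclideanSpace ℝ (Fin 3),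
      Literature.Analysis.FluidPDE.IsBoundedAncientMildSolution 1 v →
      (∀ t < 0, AEStronglyMeasurable (v t) volume) →
      ContDiffOn ℝ (⊤ : ℕ∞) (Function.uncurry v) (Set.Iio 0 ×ˢ Set.univ) →
      (∀ s t : ℝ, s < t → t < 0 → ∀ x,
        v t x = Literature.Analysis.UnboundedOperators.heatExtension (v s) (t - s) x -
          Literature.Analysis.FluidPDE.oseenDuhamel 1 s v v t x) →
      (∃ x₀ : EuclideanSpace ℝ (Fin 3), ∀ t < 0, ∀ x,
        inner ℝ (x - x₀) (Literature.Analysis.FluidPDE.curl (v t) x) = 0) →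
      ∀ t < 0, ∃ b : EuclideanSpace ℝ (Fin 3), ∀ x, v t x = b := by
  intro v hB hm hsm hmild hx₀
  obtain ⟨x₀, hun⟩ := hx₀
  exact constant_of_unthreadedRigidity_of_oseenMild h27585 v x₀ hB hm hsm hun hmild

end FrameSlot

end Summit.NavierStokesRegularity.NavierStokesRegularity.Theorems.PoloidalLiouville.Antidynamo

end
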